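import Literature.NumberTheory.Sieve.ParityWave0Proofs
import Literature.NumberTheory.Sieve.SingularSeries
import HarnessLib

/-!
# Goldston–Pintz–Yıldırım, *Primes in tuples I*: the sieve objects, Propositions 1–2, Gallagher's
# average of the singular series, and the §3 assembly of Theorem 2 (`E₁ = 0`)

Source: D. A. Goldston, J. Pintz, C. Y. Yıldırım, *Primes in tuples. I*, Ann. of Math. (2) 170
(2009), 819–862 = arXiv:math/0508185 (page numbers below are those of the arXiv version), cited as
`GoldstonPintzYildirim2009`; and P. X. Gallagher, *On the distribution of primes in short
intervals*, Mathematika 23 (1976), 4–9, eq. (3), cited as `Gallagher1976`.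

The named fact `Literature.NumberTheory.Sieve.frequently_nth_prime_gap_lt_mul_log` (**parity.S30**, in
`Literature.NumberTheory.Sieve.ParityWave0`) is GPY **Theorem 2**, display (1.8), p. 3:
`E₁ = liminf (p_{n+1} − p_n)/log p_n = 0`, in the `∃ᶠ` form "for every `ε > 0`,
`p_{n+1} − p_n < ε log p_n` for infinitely many `n`". Its printed proof (§3, p. 8, "a simple argument
due to Granville and Soundararajan") rests on three inputs, each a theorem in print that is far from
Mathlib, and vendored here as NAMED FACTS (`def … : Prop`, undischarged):

* `Literature.NumberTheory.Sieve.GPY.proposition1` — GPY **Proposition 1**, (2.14), p. 7 (proved in GPY §§6–8 by a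
  two-variable contour integral): for `R ≪ N^{1/2} (log N)^{−4M}`, `h ≤ R^C`,
  `∑_{n ≤ N} Λ_R(n; H₁, ℓ₁) Λ_R(n; H₂, ℓ₂) = C(ℓ₁+ℓ₂, ℓ₁) (log R)^{r+ℓ₁+ℓ₂}/(r+ℓ₁+ℓ₂)! (𝔖(H) + o_M(1)) N`;
* `Literature.NumberTheory.Sieve.GPY.proposition2` — GPY **Proposition 2**, (2.15), p. 7, in its UNCONDITIONAL range
  `R ≪_M N^{1/4} (log N)^{−B(M)}`, `h ≤ R` (proved in GPY §9 from the Bombieri–Vinogradov theorem):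
  the same sum twisted by `θ(n + h₀)`, `1 ≤ h₀ ≤ h`, in the three cases `h₀ ∉ H`,
  `h₀ ∈ H₁ ∖ H₂`, `h₀ ∈ H₁ ∩ H₂`;
* `Literature.NumberTheory.Sieve.GPY.gallagher_sum_singularSeries` — GPY (3.7), p. 8 = Gallagher 1976, (3):
  `∑_{1 ≤ h₁, …, h_k ≤ h distinct} 𝔖({h₁, …, h_k}) ∼ h^k` (`h → ∞`, `k` fixed).

What is PROVED here (sorry-free) is the whole of GPY §3 for Theorem 2, i.e. (3.5)–(3.10) with
`r = 1`, `ϑ = 1/2`: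

* `Literature.NumberTheory.Sieve.GPY.eventually_window_two_primes` — from the three facts, for every `0 < η ≤ 1` and all
  large `N` some interval `(n, n + h]`, `N < n ≤ 2N`, `h = ⌊(η/2) log N⌋`, contains two primes.
  As printed: with `R = N^{1/4 − ε}` and
  `S̃ = ∑_{N < n ≤ 2N} (∑_{1 ≤ h₀ ≤ h} θ(n + h₀) − log 3N) ∑_{H_k ⊆ [1,h] distinct} Λ_R(n; H_k, ℓ)²`
  ((3.5) with `r = 1`), Propositions 1–2 at `N` and `2N` and Gallagher's theorem at `k` and `k + 1`
  give (3.8), `S̃ ≳ (A log R + h − log 3N) C(2ℓ,ℓ)/(k+2ℓ)! · N h^k (log R)^{k+2ℓ}` with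
  `A = (2k/(k+2ℓ+1)) · ((2ℓ+1)/(ℓ+1))`; `S̃ > 0` forces `∑_{h₀ ≤ h} θ(n + h₀) > log 3N` for some
  `n ∈ (N, 2N]`, hence (each `θ(n + h₀) ≤ log 3N`) two primes in `(n, n + h]`. The text takes
  `ℓ = [√k/2]`, `k → ∞` so that `A → 4` ((3.9)–(3.10)); we make the choice explicit:
  `ℓ = ⌈16/η⌉`, `k = 2(ℓ+1)(2ℓ+1)` give `A ≥ 4 − η/4` (`exists_params`), and with `ε = η/64`,
  error tolerance `δ = η/64` in the three facts and `h = ⌊(η/2) log N⌋` the bracket is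
  `≥ (7η/32) log N − O(1) > 0` (`numeric_ineq`). The finite-sum bookkeeping of (3.8) is isolated in
  `sum_pos_of_bounds` (an inequality between real numbers indexed by the tuples) and
  `sum_distinctTuples_succ` (the bijection `(h₀, (h₁,…,h_k)) ↔ (h₀,h₁,…,h_k)` of distinct tuples
  behind "`∑_{H_k} ∑_{h₀ ∉ H_k} 𝔖(H_k ∪ {h₀}) = ∑_{H_{k+1}} 𝔖(H_{k+1})`").
* `Literature.NumberTheory.Sieve.GPY.frequently_nth_prime_gap_lt_mul_log_of_propositions` — **parity.S30 from the three
  facts**: two primes `p < p'` in `(n, n + h]` with `n > N` give `p_{m+1} − p_m < h ≤ (η/2) log N <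
  η log p_m` for `p_m = p`, and `m → ∞` with `N`.

So the discharge `Literature.NumberTheory.Sieve.frequently_nth_prime_gap_lt_mul_log_holds` along the SOURCE'S OWN route
is reduced to discharging `proposition1`, `proposition2` (hence Bombieri–Vinogradov, parity.S27) and
`gallagher_sum_singularSeries`; the alternative route through Maynard's sieve is
`Literature.NumberTheory.Sieve.frequently_nth_prime_gap_lt_mul_log_of_bombieri_vinogradov`
(`Literature.NumberTheory.Sieve.ParityWave0Proofs`).

## The objects (GPY §§1–2)

* `Literature.GPY.theta n = θ(n)` — `log n` at primes, `0` otherwise ((1.1), p. 3);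
* `Literature.GPY.tuplePoly H n = P_H(n) = ∏_{h ∈ H} (n + h)` ((2.8), p. 6);
* `Literature.GPY.lambdaR R H ℓ n = Λ_R(n; H, ℓ) = (1/(k+ℓ)!) ∑_{d ∣ P_H(n), d ≤ R} μ(d) (log R/d)^{k+ℓ}`,
  `k = #H` ((2.13), p. 7);
* `Literature.GPY.mainTerm a b e R = C(a, b) (log R)^e / e!`, the common shape of the main terms of
  (2.14)–(2.15);
* `Literature.GPY.singularSeriesNat H = 𝔖(H)` for `H ⊆ ℕ` — the Hardy–Littlewood singular series
  `∏_p (1 − 1/p)^{−k} (1 − ν_p(H)/p)` ((2.2), p. 6), as `Literature.NumberTheory.Sieve.singularSeries` of the cast tuple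
  (`Literature.NumberTheory.Sieve.SingularSeries`: ordered limit = absolutely convergent product,
  `Literature.NumberTheory.Sieve.hasProd_singularSeriesFactor_holds`);
* `Literature.GPY.distinctTuples k h` — the ordered `k`-tuples `1 ≤ h₁, …, h_k ≤ h` of distinct integers
  ((2.1), p. 6, and the range of summation in (3.5), (3.7)), as injective maps `Fin k → [1, h]`.

## Reading of the printed statements (design choices a reviewer should check)

* "`= main · (𝔖(H) + o_M(1)) N` as `R, N → ∞`" is rendered: for every `δ > 0` there is `R₀` such
  that `|∑ − main · 𝔖(H) · N| ≤ δ · main · N` whenever `R ≥ R₀` AND `N ≥ R₀` and the side conditions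
  hold; the rate may depend on `M` (the subscript), on `C` ("for any given constant `C > 0`") and on
  the implied constant of `R ≪ …`, and is UNIFORM in `h`, `H₁`, `H₂`, `h₀` subject to the printed
  side conditions — this uniformity is how §3 uses the propositions (sum over all `∼ h^k` tuples in
  `[1, h]`, `h ≍ log N → ∞`) and is what `o_M(1)` denotes.
* "`R ≪ X`" as a HYPOTHESIS is rendered "`R ≤ A · X` for an arbitrary fixed `A > 0`" (the threshold
  `R₀` may depend on `A`); §3 uses `A = 1`, `R = N^{ϑ/2−ε}`. In Proposition 2, "for a sufficiently
  large positive constant `B(M)`" is `∃ B > 0` depending on `M` only.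
* Standing hypotheses of §2 (p. 7) are explicit arguments: `H₁, H₂ ⊆ [0, h]` ("sets of `k₁`, `k₂`
  distinct non-negative integers `≤ h`"), at least one of them nonempty, `M = k₁ + k₂ + ℓ₁ + ℓ₂`,
  and `0 ≤ ℓᵢ ≤ kᵢ` from the definition (2.13) of `Λ_R(n; H, ℓ)`.
* `N ∈ ℕ` and the sums run over `1 ≤ n ≤ N`; `R ∈ ℝ`; exponents `N^{1/2}`, `N^{1/4}`, `R^C`,
  `(log N)^{B}` are real powers (`Real.rpow`), `(log N)^{4M}` a natural power.
* Proposition 2 is the conjunction of its three printed cases; the relabelled case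
  `h₀ ∈ H₂ ∖ H₁` of the Remark (p. 7) is not restated. Its conditional last sentence (level of
  distribution `ϑ > 1/2`: `R ≪ N^{ϑ/2−ε}`, `h ≤ R^ε`) is NOT vendored, nor are Theorem 1, Theorem 3
  and (1.9): they need GPY's `θ`-weighted level of distribution (1.3)–(1.4), which is not the
  `ψ`-weighted `Literature.NumberTheory.Sieve.PrimesHaveLevel` of `Literature.NumberTheory.Sieve.LevelOfDistribution`, and
  parity.S30 does not use them.
* Gallagher's theorem is stated for `k ≥ 1` as the limit `∑ / h^k → 1` over ORDERED distinct tuples,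
  exactly as (3.7) and Gallagher's (3) print it (`k!` times the sum over `k`-subsets of `[1, h]`).

## References

* D. A. Goldston, J. Pintz, C. Y. Yıldırım, *Primes in tuples. I*, Ann. of Math. (2) 170 (2009),
  819–862, doi:10.4007/annals.2009.170.819, arXiv:math/0508185: (1.1), (2.2), (2.8), (2.13),
  Proposition 1 (2.14), Proposition 2 (2.15), §3 (3.1)–(3.10), Theorem 2 (1.8).
  [cite: GoldstonPintzYildirim2009]
* P. X. Gallagher, *On the distribution of primes in short intervals*, Mathematika 23 (1976), 4–9,
  doi:10.1112/S0025579300016442, eq. (3) p. 5. [cite: Gallagher1976]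
-/

noncomputable section

open Filter Finset Real
open scoped Topology

namespace Literature.NumberTheory.Sieve.GPY

/-! ### The objects of GPY §§1–2 -/

/-- `θ(n) = log n` if `n` is prime and `0` otherwise (GPY (1.1), p. 3). This is the same function
as `Literature.NumberTheory.Sieve.vonMangoldtPrime` (Green–Tao's `Λ'`, `LinearEquationsInPrimesTransference.lean`, equal by
`rfl`); kept local so that this file does not import the Green–Tao transference files — a librarian
may merge the two. [cite: GoldstonPintzYildirim2009, eq. 1.1] -/
def theta (n : ℕ) : ℝ := if n.Prime then Real.log n else 0

/-- `θ(n) ≥ 0`. [folklore] -/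
theorem theta_nonneg (n : ℕ) : 0 ≤ theta n := by
  unfold theta
  split_ifs
  · exact Real.log_natCast_nonneg n
  · exact le_rfl

/-- `θ(n) ≤ log n`. [folklore] -/
theorem theta_le_log (n : ℕ) : theta n ≤ Real.log n := by
  unfold theta
  split_ifs
  · exact le_rfl
  · exact Real.log_natCast_nonneg n

/-- `θ(n) = 0` unless `n` is prime. [folklore] -/
theorem theta_of_not_prime {n : ℕ} (h : ¬ n.Prime) : theta n = 0 := by
  simp [theta, h]

/-- `P_H(n) = ∏_{h ∈ H} (n + h)` (GPY (2.8), p. 6); for `n ≥ 1` (the range of all sums below) it is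
positive, for `n = 0 ∈ H` it is `0` and `Nat.divisors 0 = ∅` makes `Λ_R(0; H, ℓ) = 0` (never used).
[cite: GoldstonPintzYildirim2009, eq. 2.8] -/
def tuplePoly (H : Finset ℕ) (n : ℕ) : ℕ := ∏ h ∈ H, (n + h)

/-- `Λ_R(n; H, ℓ) = (1/(k+ℓ)!) ∑_{d ∣ P_H(n), d ≤ R} μ(d) (log (R/d))^{k+ℓ}`, `k = #H`, `0 ≤ ℓ ≤ k`
(GPY (2.13), p. 7; the sum is over the positive divisors `d ≤ R` of `P_H(n)`, squarefree ones by
`μ`). [cite: GoldstonPintzYildirim2009, eq. 2.13] -/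
def lambdaR (R : ℝ) (H : Finset ℕ) (ℓ : ℕ) (n : ℕ) : ℝ :=
  ((#H + ℓ).factorial : ℝ)⁻¹ *
    ∑ d ∈ (tuplePoly H n).divisors.filter (fun d : ℕ => (d : ℝ) ≤ R),
      (ArithmeticFunction.moebius d : ℝ) * Real.log (R / d) ^ (#H + ℓ)

/-- Sanity unfolding: `Λ_R(n; ∅, 0) = 1` for `R ≥ 1` (only `d = 1` divides `P_∅(n) = 1`), the
normalisation by which Proposition 1 with `H₂ = ∅`, `ℓ₂ = 0` is the mean value of a single
`Λ_R(n; H₁, ℓ₁)`. [folklore] -/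
theorem lambdaR_empty_zero {R : ℝ} (hR : 1 ≤ R) (n : ℕ) : lambdaR R ∅ 0 n = 1 := by
  have h1 : (Nat.divisors 1).filter (fun d : ℕ => (d : ℝ) ≤ R) = {1} := by
    rw [Nat.divisors_one, Finset.filter_singleton]
    simp [hR]
  unfold lambdaR tuplePoly
  rw [Finset.prod_empty, h1, Finset.sum_singleton]
  simp

/-- The common shape `C(a, b) (log R)^e / e!` of the main terms in GPY Propositions 1–2
((2.14)–(2.15), p. 7): `mainTerm (ℓ₁+ℓ₂) ℓ₁ (r+ℓ₁+ℓ₂) R = C(ℓ₁+ℓ₂, ℓ₁) (log R)^{r+ℓ₁+ℓ₂}/(r+ℓ₁+ℓ₂)!`.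
[cite: GoldstonPintzYildirim2009, Proposition 1 eq. 2.14] -/
def mainTerm (a b e : ℕ) (R : ℝ) : ℝ :=
  (a.choose b : ℝ) * Real.log R ^ e / (e.factorial : ℝ)

/-- `mainTerm a b e R > 0` for `b ≤ a` and `R > 1`. [folklore] -/
theorem mainTerm_pos {a b e : ℕ} (hab : b ≤ a) {R : ℝ} (hR : 1 < R) : 0 < mainTerm a b e R := by
  unfold mainTerm
  have h1 : (0 : ℝ) < a.choose b := by exact_mod_cast Nat.choose_pos hab
  have h2 : 0 < Real.log R := Real.log_pos hR
  positivity

/-- `𝔖(H) = ∏_p (1 − 1/p)^{−k} (1 − ν_p(H)/p)` for a tuple `H ⊆ ℕ` (GPY (2.2), p. 6): the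
Hardy–Littlewood singular series `Literature.NumberTheory.Sieve.singularSeries` of the tuple cast to `ℤ`.
[cite: GoldstonPintzYildirim2009, eq. 2.2] -/
def singularSeriesNat (H : Finset ℕ) : ℝ := singularSeries (H.image ((↑) : ℕ → ℤ))

/-- Unfolding lemma for `singularSeriesNat` (definition). [folklore] -/
theorem singularSeriesNat_def (H : Finset ℕ) :
    singularSeriesNat H = singularSeries (H.image ((↑) : ℕ → ℤ)) := rfl

/-- The ordered `k`-tuples `(h₁, …, h_k)` of DISTINCT integers `1 ≤ hᵢ ≤ h` (GPY (2.1), p. 6; the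
range of summation in (3.5) and (3.7), p. 8), as the injective maps `Fin k → [1, h]`.
[cite: GoldstonPintzYildirim2009, eq. 2.1 and 3.5] -/
def distinctTuples (k h : ℕ) : Finset (Fin k → ℕ) :=
  (Fintype.piFinset fun _ : Fin k => Icc 1 h).filter fun t => Function.Injective t

/-- Membership in `distinctTuples k h`: values in `[1, h]` and injective. [folklore] -/
theorem mem_distinctTuples {k h : ℕ} {t : Fin k → ℕ} :
    t ∈ distinctTuples k h ↔ (∀ i, t i ∈ Icc 1 h) ∧ Function.Injective t := by
  simp [distinctTuples, Fintype.mem_piFinset]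

/-- There are at most `h^k` distinct `k`-tuples in `[1, h]` (exactly `h(h−1)⋯(h−k+1)`). [folklore] -/
theorem card_distinctTuples_le (k h : ℕ) : #(distinctTuples k h) ≤ h ^ k := by
  calc #(distinctTuples k h) ≤ #(Fintype.piFinset fun _ : Fin k => Icc 1 h) :=
        Finset.card_filter_le _ _
    _ = h ^ k := by rw [Fintype.card_piFinset_const, Nat.card_Icc]; simp

/-- The set `{h₁, …, h_k}` of a distinct tuple lies in `[1, h]`. [folklore] -/
theorem image_subset_of_mem_distinctTuples {k h : ℕ} {t : Fin k → ℕ}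
    (ht : t ∈ distinctTuples k h) : univ.image t ⊆ Icc 1 h := by
  intro x hx
  obtain ⟨i, -, rfl⟩ := Finset.mem_image.1 hx
  exact (mem_distinctTuples.1 ht).1 i

/-- The set `{h₁, …, h_k}` of a distinct `k`-tuple has `k` elements. [folklore] -/
theorem card_image_of_mem_distinctTuples {k h : ℕ} {t : Fin k → ℕ}
    (ht : t ∈ distinctTuples k h) : #(univ.image t) = k := by
  rw [Finset.card_image_of_injective _ (mem_distinctTuples.1 ht).2, Finset.card_univ,
    Fintype.card_fin]

/-! ### The three inputs of GPY §3, as named facts -/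

/-- **GPY Proposition 1** ((2.14), p. 7; proved in §§6–8). Let `H₁, H₂` be sets of `k₁, k₂`
non-negative integers `≤ h`, not both empty, `0 ≤ ℓᵢ ≤ kᵢ`, `M = k₁ + k₂ + ℓ₁ + ℓ₂`,
`H = H₁ ∪ H₂`, `r = #(H₁ ∩ H₂)`. If `R ≪ N^{1/2} (log N)^{−4M}` and `h ≤ R^C` for any given
constant `C > 0`, then as `R, N → ∞`,
`∑_{n ≤ N} Λ_R(n; H₁, ℓ₁) Λ_R(n; H₂, ℓ₂) = C(ℓ₁+ℓ₂, ℓ₁) (log R)^{r+ℓ₁+ℓ₂}/(r+ℓ₁+ℓ₂)! (𝔖(H) + o_M(1)) N`.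
Rendered (see the module docstring): for all `M`, `C, A, δ > 0` there is `R₀` such that for
`R, N ≥ R₀`, `R ≤ A N^{1/2}/(log N)^{4M}`, `h ≤ R^C` and all such `H₁, H₂, ℓ₁, ℓ₂`,
`|∑ − main · 𝔖(H) · N| ≤ δ · main · N`, uniformly. A deep theorem, not in Mathlib.
[cite: GoldstonPintzYildirim2009, Proposition 1 eq. 2.14] -/
def proposition1 : Prop :=
  ∀ (M : ℕ) (C A δ : ℝ), 0 < C → 0 < A → 0 < δ →
    ∃ R₀ : ℝ, ∀ (R : ℝ) (N h : ℕ) (H₁ H₂ : Finset ℕ) (ℓ₁ ℓ₂ : ℕ),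
      R₀ ≤ R → R₀ ≤ (N : ℝ) →
      R ≤ A * (N : ℝ) ^ (1 / 2 : ℝ) / Real.log N ^ (4 * M) →
      (h : ℝ) ≤ R ^ C →
      (∀ x ∈ H₁, x ≤ h) → (∀ x ∈ H₂, x ≤ h) → (H₁.Nonempty ∨ H₂.Nonempty) →
      ℓ₁ ≤ #H₁ → ℓ₂ ≤ #H₂ → #H₁ + #H₂ + ℓ₁ + ℓ₂ = M →
      |∑ n ∈ Icc 1 N, lambdaR R H₁ ℓ₁ n * lambdaR R H₂ ℓ₂ n -
          mainTerm (ℓ₁ + ℓ₂) ℓ₁ (#(H₁ ∩ H₂) + ℓ₁ + ℓ₂) R *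
            singularSeriesNat (H₁ ∪ H₂) * N| ≤
        δ * (mainTerm (ℓ₁ + ℓ₂) ℓ₁ (#(H₁ ∩ H₂) + ℓ₁ + ℓ₂) R * N)

/-- **GPY Proposition 2**, unconditional range ((2.15), p. 7; proved in §9 from the
Bombieri–Vinogradov theorem). With `H₁, H₂, ℓ₁, ℓ₂, M, H, r` as in Proposition 1, `1 ≤ h₀ ≤ h` and
`H⁰ = H ∪ {h₀}`: if `R ≪_M N^{1/4} (log N)^{−B(M)}` for a sufficiently large positive constant
`B(M)`, and `h ≤ R`, then as `R, N → ∞`, `∑_{n ≤ N} Λ_R(n; H₁, ℓ₁) Λ_R(n; H₂, ℓ₂) θ(n + h₀)` equals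
`C(ℓ₁+ℓ₂, ℓ₁) (log R)^{r+ℓ₁+ℓ₂}/(r+ℓ₁+ℓ₂)! (𝔖(H⁰) + o_M(1)) N` if `h₀ ∉ H`;
`C(ℓ₁+ℓ₂+1, ℓ₁+1) (log R)^{r+ℓ₁+ℓ₂+1}/(r+ℓ₁+ℓ₂+1)! (𝔖(H) + o_M(1)) N` if `h₀ ∈ H₁`, `h₀ ∉ H₂`;
`C(ℓ₁+ℓ₂+2, ℓ₁+1) (log R)^{r+ℓ₁+ℓ₂+1}/(r+ℓ₁+ℓ₂+1)! (𝔖(H) + o_M(1)) N` if `h₀ ∈ H₁ ∩ H₂`.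
Rendered as for Proposition 1 (`∀ M, ∃ B > 0, ∀ A, δ > 0, ∃ R₀, …`), the three cases as a
conjunction of implications; the relabelled case `h₀ ∈ H₂ ∖ H₁` (Remark, p. 7) and the conditional
range under a level of distribution `ϑ > 1/2` are not restated. A deep theorem, not in Mathlib.
[cite: GoldstonPintzYildirim2009, Proposition 2 eq. 2.15] -/
def proposition2 : Prop :=
  ∀ M : ℕ, ∃ B : ℝ, 0 < B ∧ ∀ (A δ : ℝ), 0 < A → 0 < δ →
    ∃ R₀ : ℝ, ∀ (R : ℝ) (N h h₀ : ℕ) (H₁ H₂ : Finset ℕ) (ℓ₁ ℓ₂ : ℕ),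
      R₀ ≤ R → R₀ ≤ (N : ℝ) →
      R ≤ A * (N : ℝ) ^ (1 / 4 : ℝ) / Real.log N ^ B →
      (h : ℝ) ≤ R → 1 ≤ h₀ → h₀ ≤ h →
      (∀ x ∈ H₁, x ≤ h) → (∀ x ∈ H₂, x ≤ h) → (H₁.Nonempty ∨ H₂.Nonempty) →
      ℓ₁ ≤ #H₁ → ℓ₂ ≤ #H₂ → #H₁ + #H₂ + ℓ₁ + ℓ₂ = M →
      (h₀ ∉ H₁ ∪ H₂ →
        |∑ n ∈ Icc 1 N, lambdaR R H₁ ℓ₁ n * lambdaR R H₂ ℓ₂ n * theta (n + h₀) -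
            mainTerm (ℓ₁ + ℓ₂) ℓ₁ (#(H₁ ∩ H₂) + ℓ₁ + ℓ₂) R *
              singularSeriesNat (insert h₀ (H₁ ∪ H₂)) * N| ≤
          δ * (mainTerm (ℓ₁ + ℓ₂) ℓ₁ (#(H₁ ∩ H₂) + ℓ₁ + ℓ₂) R * N)) ∧
      (h₀ ∈ H₁ → h₀ ∉ H₂ →
        |∑ n ∈ Icc 1 N, lambdaR R H₁ ℓ₁ n * lambdaR R H₂ ℓ₂ n * theta (n + h₀) -
            mainTerm (ℓ₁ + ℓ₂ + 1) (ℓ₁ + 1) (#(H₁ ∩ H₂) + ℓ₁ + ℓ₂ + 1) R *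
              singularSeriesNat (H₁ ∪ H₂) * N| ≤
          δ * (mainTerm (ℓ₁ + ℓ₂ + 1) (ℓ₁ + 1) (#(H₁ ∩ H₂) + ℓ₁ + ℓ₂ + 1) R * N)) ∧
      (h₀ ∈ H₁ ∩ H₂ →
        |∑ n ∈ Icc 1 N, lambdaR R H₁ ℓ₁ n * lambdaR R H₂ ℓ₂ n * theta (n + h₀) -
            mainTerm (ℓ₁ + ℓ₂ + 2) (ℓ₁ + 1) (#(H₁ ∩ H₂) + ℓ₁ + ℓ₂ + 1) R *
              singularSeriesNat (H₁ ∪ H₂) * N| ≤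
          δ * (mainTerm (ℓ₁ + ℓ₂ + 2) (ℓ₁ + 1) (#(H₁ ∩ H₂) + ℓ₁ + ℓ₂ + 1) R * N))

/-- **Gallagher's theorem on the average of the singular series** (Gallagher, Mathematika 23
(1976), eq. (3), p. 5: "for each `r`, `𝔖_d` averages to `1` over cubes:
`∑_{1 ≤ d₁, …, d_r ≤ h, distinct} 𝔖_d ∼ h^r` (`h → ∞`)"; quoted as GPY (3.7), p. 8). Stated for
`k ≥ 1` over ordered distinct tuples as the limit `∑ / h^k → 1`. Not in Mathlib (Gallagher's proof:
truncate the Euler product at `y`, count tuples by their residues modulo `∏_{p ≤ y} p`, bound the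
tail). [cite: Gallagher1976, eq. 3] -/
def gallagher_sum_singularSeries : Prop :=
  ∀ k : ℕ, 1 ≤ k →
    Tendsto (fun h : ℕ =>
      (∑ t ∈ distinctTuples k h, singularSeriesNat (univ.image t)) / (h : ℝ) ^ k) atTop (𝓝 1)


/-! ### GPY §3 for Theorem 2: from `S̃ > 0` to two primes in a window -/

/-- The `θ`-sum over a window is the sum of `log` over the primes in it. [folklore] -/
theorem sum_theta_eq_sum_filter (n h : ℕ) :
    ∑ h₀ ∈ Icc 1 h, theta (n + h₀) =
      ∑ h₀ ∈ (Icc 1 h).filter (fun h₀ => (n + h₀).Prime), Real.log ((n + h₀ : ℕ) : ℝ) := by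
  rw [Finset.sum_filter]
  refine Finset.sum_congr rfl fun h₀ _ => ?_
  unfold theta
  rfl

/-- GPY §3, after (3.8) ("there are at least `r + 1` primes in some interval `(n, n + h]`", here
`r = 1`): if `∑_{1 ≤ h₀ ≤ h} θ(n + h₀) > log 3N` with `n ≤ 2N`, `h ≤ N`, then, each `θ(n + h₀)`
being at most `log (2N + h) ≤ log 3N`, at least two of the `n + h₀` are prime.
[cite: GoldstonPintzYildirim2009, Section 3 after eq. 3.8] -/
theorem exists_two_primes_of_lt_sum_theta {N n h : ℕ} (hN : 1 ≤ N) (hn : n ≤ 2 * N) (hh : h ≤ N)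
    (hsum : Real.log (3 * N) < ∑ h₀ ∈ Icc 1 h, theta (n + h₀)) :
    ∃ a b : ℕ, 1 ≤ a ∧ a < b ∧ b ≤ h ∧ (n + a).Prime ∧ (n + b).Prime := by
  rw [sum_theta_eq_sum_filter] at hsum
  set P := (Icc 1 h).filter (fun h₀ => (n + h₀).Prime) with hP
  have hlog3N : 0 ≤ Real.log (3 * N) := by
    apply Real.log_nonneg
    have : (1 : ℝ) ≤ N := by exact_mod_cast hN
    linarith
  have hbound : ∀ h₀ ∈ P, Real.log ((n + h₀ : ℕ) : ℝ) ≤ Real.log (3 * N) := by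
    intro h₀ hh₀
    rw [hP, Finset.mem_filter, Finset.mem_Icc] at hh₀
    have h1 : (0 : ℝ) < (n + h₀ : ℕ) := by exact_mod_cast (by omega : 0 < n + h₀)
    have h2 : ((n + h₀ : ℕ) : ℝ) ≤ 3 * N := by
      have : n + h₀ ≤ 3 * N := by omega
      exact_mod_cast this
    exact Real.log_le_log h1 h2
  have hcard : 1 < #P := by
    by_contra hle
    rw [not_lt] at hle
    have : ∑ h₀ ∈ P, Real.log ((n + h₀ : ℕ) : ℝ) ≤ Real.log (3 * N) := by
      calc ∑ h₀ ∈ P, Real.log ((n + h₀ : ℕ) : ℝ) ≤ ∑ h₀ ∈ P, Real.log (3 * N) :=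
            Finset.sum_le_sum hbound
        _ = #P * Real.log (3 * N) := by rw [Finset.sum_const, nsmul_eq_mul]
        _ ≤ 1 * Real.log (3 * N) := by
            gcongr
            exact_mod_cast hle
        _ = Real.log (3 * N) := one_mul _
    linarith
  obtain ⟨a, ha, b, hb, hab⟩ := Finset.one_lt_card.1 hcard
  rw [hP, Finset.mem_filter, Finset.mem_Icc] at ha hb
  rcases lt_or_gt_of_ne hab with hlt | hlt
  · exact ⟨a, b, ha.1.1, hlt, hb.1.2, ha.2, hb.2⟩
  · exact ⟨b, a, hb.1.1, hlt, ha.1.2, hb.2, ha.2⟩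

/-- The last lines of GPY §3 for `r = 1`: if for all large `N` some window `(n, n + h(N)]` with
`n > N` contains two primes, where `h(N) ≤ (η/2) log N` and `η ≤ ε`, then
`p_{m+1} − p_m < ε log p_m` for infinitely many `m` (index the smaller prime as `p_m`; `p_m > N`, so
`h(N) ≤ (η/2) log N < ε log p_m`, and `m → ∞` with `N`).
[cite: GoldstonPintzYildirim2009, Section 3 eq. 3.9 to 3.10] -/
theorem frequently_gap_lt_of_windows {ε η : ℝ} (hε : 0 < ε) (hηε : η ≤ ε) (hh : ℕ → ℕ)
    (hhle : ∀ᶠ N : ℕ in atTop, (hh N : ℝ) ≤ η / 2 * Real.log N)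
    (hwin : ∀ᶠ N : ℕ in atTop, ∃ n a b : ℕ, N < n ∧ 1 ≤ a ∧ a < b ∧ b ≤ hh N ∧
      (n + a).Prime ∧ (n + b).Prime) :
    ∃ᶠ m : ℕ in atTop, (Nat.nth Nat.Prime (m + 1) : ℝ) - Nat.nth Nat.Prime m <
      ε * Real.log (Nat.nth Nat.Prime m) := by
  refine Filter.frequently_atTop.2 fun M => ?_
  obtain ⟨N₀, hN₀⟩ := Filter.eventually_atTop.1 (hhle.and hwin)
  set N := max N₀ (max 1 (Nat.nth Nat.Prime M)) with hNdef
  obtain ⟨hle, n, a, b, hNn, ha, hab, hb, hpa, hpb⟩ := hN₀ N (le_max_left _ _)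
  have hN1 : 1 ≤ N := le_trans (le_max_left _ _) (le_max_right _ _)
  have hNM : Nat.nth Nat.Prime M ≤ N := le_trans (le_max_right _ _) (le_max_right _ _)
  refine ⟨Nat.count Nat.Prime (n + a), ?_, ?_⟩
  · by_contra hcon
    have := Nat.nth_strictMono (p := Nat.Prime) Nat.infinite_setOf_prime (not_le.1 hcon)
    rw [Nat.nth_count hpa] at this
    omega
  · rw [Nat.nth_count hpa]
    have h1 : Nat.nth Nat.Prime (Nat.count Nat.Prime (n + a) + 1) ≤ n + b :=
      Literature.NumberTheory.Sieve.nth_prime_count_add_one_le hpa hpb (by omega)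
    have h2 : (Nat.nth Nat.Prime (Nat.count Nat.Prime (n + a) + 1) : ℝ) ≤ (n + b : ℕ) := by
      exact_mod_cast h1
    have h3 : ((n + b : ℕ) : ℝ) - (n + a : ℕ) < hh N := by
      have : ((n + b : ℕ) : ℝ) - (n + a : ℕ) = ((b - a : ℕ) : ℝ) := by
        push_cast [Nat.cast_sub hab.le]
        ring
      rw [this]
      exact_mod_cast (by omega : b - a < hh N)
    have hNpos : (0 : ℝ) < N := by exact_mod_cast hN1
    have h4 : Real.log N ≤ Real.log ((n + a : ℕ) : ℝ) :=
      Real.log_le_log hNpos (by exact_mod_cast (by omega : N ≤ n + a))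
    have h5 : 0 < Real.log ((n + a : ℕ) : ℝ) := by
      apply Real.log_pos
      have : 2 ≤ n + a := hpa.two_le
      exact_mod_cast (by omega : 1 < n + a)
    have h6 : 0 ≤ Real.log N := Real.log_nonneg (by exact_mod_cast hN1)
    have h7 : η / 2 * Real.log N ≤ ε / 2 * Real.log ((n + a : ℕ) : ℝ) := by
      calc η / 2 * Real.log N ≤ ε / 2 * Real.log N := by gcongr
        _ ≤ ε / 2 * Real.log ((n + a : ℕ) : ℝ) := by gcongr
    nlinarith

/-! ### GPY §3 for Theorem 2: the inequality (3.8) in the abstract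

The lower bound for `S̃` uses only finitely many real numbers attached to the distinct `k`-tuples
`t` (with set `H_t`) in `[1, h]`: `a(t) = ∑_{N<n≤2N} Λ_R(n; H_t, ℓ)²`,
`b(t, h₀) = ∑_{N<n≤2N} Λ_R(n; H_t, ℓ)² θ(n + h₀)`, the singular series `𝔖(H_t)`, `𝔖(H_t ∪ {h₀})`,
and the bounds Propositions 1–2 and Gallagher's theorem provide for them. `sum_pos_of_bounds` is that
deduction with all number theory abstracted away. -/

/-- **GPY (3.8) in the abstract.** Index set `T` (the distinct `k`-tuples), `im t ⊆ I = [1, h]`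
of size `k`, reals `a t`, `b t h₀`, a set function `S` (the singular series) and constants with:
`a t ≤ X (S(im t) + 3δ)` (Proposition 1 on `(N, 2N]`), `b t h₀ ≥ Y (S(im t) − 3δ)` for `h₀ ∈ im t`
and `b t h₀ ≥ X (S(im t ∪ {h₀}) − 3δ)` for `h₀ ∉ im t` (Proposition 2), `k Y = X · ALR`
(`ALR = A log R`, the ratio of the two main terms), `|∑_t S(im t) − h^k| ≤ δ h^k` and
`∑_t ∑_{h₀ ∉ im t} S(im t ∪ {h₀}) ≥ (1 − δ) h^{k+1}` (Gallagher at `k` and `k + 1`), `#T ≤ h^k`.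
Then `∑_t (∑_{h₀ ∈ I} b t h₀ − L3N · a t) ≥ X h^k (ALR (1 − 4δ) + h (1 − 4δ) − L3N (1 + 4δ)) > 0`.
[cite: GoldstonPintzYildirim2009, Section 3 eq. 3.8] -/
theorem sum_pos_of_bounds {τ : Type*} (T : Finset τ) (im : τ → Finset ℕ) (I : Finset ℕ)
    (a : τ → ℝ) (b : τ → ℕ → ℝ) (S : Finset ℕ → ℝ)
    {X Y ALR L3N δ hr : ℝ} {k : ℕ}
    (hX : 0 < X) (hhr : 0 < hr) (hALR : 0 ≤ ALR) (hL3N : 0 ≤ L3N) (hδ : 0 ≤ δ)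
    (hkY : (k : ℝ) * Y = X * ALR)
    (hT : (#T : ℝ) ≤ hr ^ k) (hI : (#I : ℝ) = hr)
    (himI : ∀ t ∈ T, im t ⊆ I) (hcard : ∀ t ∈ T, #(im t) = k)
    (ha : ∀ t ∈ T, a t ≤ X * (S (im t) + 3 * δ))
    (hb_in : ∀ t ∈ T, ∀ h₀ ∈ im t, Y * (S (im t) - 3 * δ) ≤ b t h₀)
    (hb_out : ∀ t ∈ T, ∀ h₀ ∈ I \ im t, X * (S (insert h₀ (im t)) - 3 * δ) ≤ b t h₀)
    (hG1 : |∑ t ∈ T, S (im t) - hr ^ k| ≤ δ * hr ^ k)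
    (hG2 : (1 - δ) * hr ^ (k + 1) ≤ ∑ t ∈ T, ∑ h₀ ∈ I \ im t, S (insert h₀ (im t)))
    (hnum : 0 < ALR * (1 - 4 * δ) + hr * (1 - 4 * δ) - L3N * (1 + 4 * δ)) :
    0 < ∑ t ∈ T, (∑ h₀ ∈ I, b t h₀ - L3N * a t) := by
  -- per-tuple lower bound
  have key : ∀ t ∈ T,
      X * ((ALR - L3N) * S (im t) + ∑ h₀ ∈ I \ im t, S (insert h₀ (im t))
        - 3 * δ * (ALR + hr + L3N)) ≤ ∑ h₀ ∈ I, b t h₀ - L3N * a t := by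
    intro t ht
    have h1 : ∑ h₀ ∈ I, b t h₀ = ∑ h₀ ∈ I \ im t, b t h₀ + ∑ h₀ ∈ im t, b t h₀ :=
      (Finset.sum_sdiff (himI t ht)).symm
    have h2 : X * ALR * (S (im t) - 3 * δ) ≤ ∑ h₀ ∈ im t, b t h₀ := by
      calc X * ALR * (S (im t) - 3 * δ) = ∑ h₀ ∈ im t, Y * (S (im t) - 3 * δ) := by
            rw [Finset.sum_const, nsmul_eq_mul, hcard t ht, ← mul_assoc, hkY]
        _ ≤ ∑ h₀ ∈ im t, b t h₀ := Finset.sum_le_sum (hb_in t ht)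
    have h3 : X * ∑ h₀ ∈ I \ im t, S (insert h₀ (im t)) - 3 * δ * X * #(I \ im t) ≤
        ∑ h₀ ∈ I \ im t, b t h₀ := by
      calc X * ∑ h₀ ∈ I \ im t, S (insert h₀ (im t)) - 3 * δ * X * #(I \ im t)
          = ∑ h₀ ∈ I \ im t, X * (S (insert h₀ (im t)) - 3 * δ) := by
            simp only [mul_sub, Finset.sum_sub_distrib, Finset.mul_sum, Finset.sum_const,
              nsmul_eq_mul]
            ring
        _ ≤ ∑ h₀ ∈ I \ im t, b t h₀ := Finset.sum_le_sum (hb_out t ht)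
    have h4 : (#(I \ im t) : ℝ) ≤ hr := by
      rw [← hI]
      exact_mod_cast Finset.card_le_card Finset.sdiff_subset
    have h4' : 3 * δ * X * #(I \ im t) ≤ 3 * δ * X * hr :=
      mul_le_mul_of_nonneg_left h4 (by positivity)
    have h5 : L3N * a t ≤ L3N * (X * (S (im t) + 3 * δ)) :=
      mul_le_mul_of_nonneg_left (ha t ht) hL3N
    rw [h1]
    nlinarith [h2, h3, h4', h5]
  -- sum over the tuples
  have hsum : ∑ t ∈ T, X * ((ALR - L3N) * S (im t) + ∑ h₀ ∈ I \ im t, S (insert h₀ (im t))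
        - 3 * δ * (ALR + hr + L3N)) ≤ ∑ t ∈ T, (∑ h₀ ∈ I, b t h₀ - L3N * a t) :=
    Finset.sum_le_sum key
  have hexp : ∑ t ∈ T, X * ((ALR - L3N) * S (im t) + ∑ h₀ ∈ I \ im t, S (insert h₀ (im t))
        - 3 * δ * (ALR + hr + L3N)) =
      X * ((ALR - L3N) * ∑ t ∈ T, S (im t) + ∑ t ∈ T, ∑ h₀ ∈ I \ im t, S (insert h₀ (im t))
        - 3 * δ * (ALR + hr + L3N) * #T) := by
    rw [← Finset.mul_sum, Finset.sum_sub_distrib, Finset.sum_add_distrib, ← Finset.mul_sum,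
      Finset.sum_const, nsmul_eq_mul]
    ring
  rw [hexp] at hsum
  -- the Gallagher inputs
  obtain ⟨hG1l, hG1u⟩ := abs_le.1 hG1
  set e := ∑ t ∈ T, S (im t) - hr ^ k with he
  have hSsum : ∑ t ∈ T, S (im t) = hr ^ k + e := by rw [he]; ring
  have hrk : 0 < hr ^ k := pow_pos hhr k
  have he1 : ALR * (-(δ * hr ^ k)) ≤ ALR * e := mul_le_mul_of_nonneg_left hG1l hALR
  have he2 : L3N * e ≤ L3N * (δ * hr ^ k) := mul_le_mul_of_nonneg_left hG1u hL3N
  have hT' : 3 * δ * (ALR + hr + L3N) * #T ≤ 3 * δ * (ALR + hr + L3N) * hr ^ k :=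
    mul_le_mul_of_nonneg_left hT (by positivity)
  have hmain : hr ^ k * (ALR * (1 - 4 * δ) + hr * (1 - 4 * δ) - L3N * (1 + 4 * δ)) ≤
      (ALR - L3N) * ∑ t ∈ T, S (im t) + ∑ t ∈ T, ∑ h₀ ∈ I \ im t, S (insert h₀ (im t))
        - 3 * δ * (ALR + hr + L3N) * #T := by
    rw [hSsum, pow_succ] at *
    nlinarith [he1, he2, hT', hG2]
  have hpos : 0 < hr ^ k * (ALR * (1 - 4 * δ) + hr * (1 - 4 * δ) - L3N * (1 + 4 * δ)) :=
    mul_pos hrk hnum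
  calc (0 : ℝ) < X * (hr ^ k * (ALR * (1 - 4 * δ) + hr * (1 - 4 * δ) - L3N * (1 + 4 * δ))) :=
        mul_pos hX hpos
    _ ≤ X * ((ALR - L3N) * ∑ t ∈ T, S (im t) + ∑ t ∈ T, ∑ h₀ ∈ I \ im t, S (insert h₀ (im t))
        - 3 * δ * (ALR + hr + L3N) * #T) := mul_le_mul_of_nonneg_left hmain hX.le
    _ ≤ _ := hsum

/-- `{h₁, …, h_{k+1}} = {h₁} ∪ {h₂, …, h_{k+1}}` for a `(k+1)`-tuple. [folklore] -/
theorem image_univ_fin_succ {k : ℕ} (t : Fin (k + 1) → ℕ) :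
    univ.image t = insert (t 0) (univ.image (Fin.tail t)) := by
  ext x
  simp only [Finset.mem_image, Finset.mem_univ, true_and, Finset.mem_insert, Fin.exists_fin_succ]
  constructor
  · rintro (h | ⟨i, hi⟩)
    · exact Or.inl h.symm
    · exact Or.inr ⟨i, hi⟩
  · rintro (h | ⟨i, hi⟩)
    · exact Or.inl h.symm
    · exact Or.inr ⟨i, hi⟩

/-- `{h₀, h₁, …, h_k} = {h₀} ∪ {h₁, …, h_k}` for the tuple `Fin.cons h₀ t`. [folklore] -/
theorem image_univ_cons {k : ℕ} (h₀ : ℕ) (t : Fin k → ℕ) :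
    univ.image (Fin.cons h₀ t : Fin (k + 1) → ℕ) = insert h₀ (univ.image t) := by
  rw [image_univ_fin_succ, Fin.cons_zero, Fin.tail_cons]

/-- The bijection `(h₀, (h₁, …, h_k)) ↔ (h₀, h₁, …, h_k)` between a distinct `k`-tuple together
with a further distinct `h₀ ∈ [1, h]` and a distinct `(k+1)`-tuple, for sums of a SET function:
`∑_{H_{k+1}} F(H_{k+1}) = ∑_{H_k} ∑_{h₀ ∈ [1,h] ∖ H_k} F(H_k ∪ {h₀})` (ordered tuples on both sides).
This is how (3.6) summed over `h₀ ∉ H_k` meets Gallagher's (3.7) at `k + 1` in GPY (3.8).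
[cite: GoldstonPintzYildirim2009, Section 3 eq. 3.8] -/
theorem sum_distinctTuples_succ (k h : ℕ) (F : Finset ℕ → ℝ) :
    ∑ t ∈ distinctTuples (k + 1) h, F (univ.image t) =
      ∑ t ∈ distinctTuples k h, ∑ h₀ ∈ Icc 1 h \ univ.image t, F (insert h₀ (univ.image t)) := by
  rw [Finset.sum_sigma']
  refine Finset.sum_nbij' (fun t => (⟨Fin.tail t, t 0⟩ : Σ _ : Fin k → ℕ, ℕ))
    (fun p => Fin.cons p.2 p.1) ?_ ?_ ?_ ?_ ?_
  · intro t ht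
    rw [mem_distinctTuples] at ht
    obtain ⟨hmem, hinj⟩ := ht
    rw [← Fin.cons_self_tail t, Fin.cons_injective_iff] at hinj
    rw [Finset.mem_sigma, mem_distinctTuples, Finset.mem_sdiff]
    refine ⟨⟨fun i => hmem i.succ, hinj.2⟩, hmem 0, ?_⟩
    intro hx
    obtain ⟨i, -, hi⟩ := Finset.mem_image.1 hx
    exact hinj.1 ⟨i, hi⟩
  · rintro ⟨t, h₀⟩ hp
    rw [Finset.mem_sigma, mem_distinctTuples, Finset.mem_sdiff] at hp
    obtain ⟨⟨hmem, hinj⟩, hh₀, hnot⟩ := hp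
    rw [mem_distinctTuples]
    refine ⟨?_, ?_⟩
    · refine Fin.cases ?_ (fun i => ?_)
      · simpa using hh₀
      · simpa using hmem i
    · refine Fin.cons_injective_iff.2 ⟨?_, hinj⟩
      rintro ⟨i, hi⟩
      exact hnot (Finset.mem_image.2 ⟨i, Finset.mem_univ _, hi⟩)
  · intro t _
    exact Fin.cons_self_tail t
  · rintro ⟨t, h₀⟩ _
    simp
  · intro t _
    simp only [image_univ_fin_succ t]

/-- The bookkeeping identity behind (3.5)/(3.8): expanding
`S̃ = ∑_{n} (∑_{h₀ ∈ I} θ'(n + h₀) − L) ∑_t Λ²_t(n)` as `∑_t (∑_{h₀ ∈ I} ∑_n Λ²_t(n) θ'(n + h₀) − L ∑_n Λ²_t(n))`.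
[folklore] -/
theorem sumTilde_eq {τ : Type*} (Nset I : Finset ℕ) (T : Finset τ) (Λsq : τ → ℕ → ℝ)
    (θ' : ℕ → ℝ) (L3N : ℝ) :
    ∑ n ∈ Nset, (∑ h₀ ∈ I, θ' (n + h₀) - L3N) * ∑ t ∈ T, Λsq t n =
      ∑ t ∈ T, (∑ h₀ ∈ I, ∑ n ∈ Nset, Λsq t n * θ' (n + h₀) - L3N * ∑ n ∈ Nset, Λsq t n) := by
  symm
  calc ∑ t ∈ T, (∑ h₀ ∈ I, ∑ n ∈ Nset, Λsq t n * θ' (n + h₀) - L3N * ∑ n ∈ Nset, Λsq t n)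
      = ∑ t ∈ T, ∑ n ∈ Nset, (∑ h₀ ∈ I, θ' (n + h₀) - L3N) * Λsq t n := by
        refine Finset.sum_congr rfl fun t _ => ?_
        rw [Finset.sum_comm, Finset.mul_sum, ← Finset.sum_sub_distrib]
        refine Finset.sum_congr rfl fun n _ => ?_
        rw [sub_mul, Finset.sum_mul,
          show (∑ h₀ ∈ I, Λsq t n * θ' (n + h₀)) = ∑ h₀ ∈ I, θ' (n + h₀) * Λsq t n from
            Finset.sum_congr rfl fun _ _ => mul_comm _ _]
    _ = ∑ n ∈ Nset, ∑ t ∈ T, (∑ h₀ ∈ I, θ' (n + h₀) - L3N) * Λsq t n := Finset.sum_comm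
    _ = _ := by
        refine Finset.sum_congr rfl fun n _ => ?_
        rw [Finset.mul_sum]

/-- "`S̃ > 0` implies `∑_{h₀ ≤ h} θ(n + h₀) > r log 3N` for some `n`" (GPY §3, the sentence after
(3.3) and its analogue for (3.5)): the weights `∑_t Λ²_t(n)` are nonnegative.
[cite: GoldstonPintzYildirim2009, Section 3 after eq. 3.3] -/
theorem exists_of_sumTilde_pos {τ : Type*} (Nset I : Finset ℕ) (T : Finset τ) (Λsq : τ → ℕ → ℝ)
    (θ' : ℕ → ℝ) (L3N : ℝ) (hΛ : ∀ t n, 0 ≤ Λsq t n)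
    (hpos : 0 < ∑ n ∈ Nset, (∑ h₀ ∈ I, θ' (n + h₀) - L3N) * ∑ t ∈ T, Λsq t n) :
    ∃ n ∈ Nset, L3N < ∑ h₀ ∈ I, θ' (n + h₀) := by
  by_contra hcon
  push Not at hcon
  have : ∑ n ∈ Nset, (∑ h₀ ∈ I, θ' (n + h₀) - L3N) * ∑ t ∈ T, Λsq t n ≤ 0 := by
    refine Finset.sum_nonpos fun n hn => ?_
    exact mul_nonpos_iff.2 (Or.inr ⟨by linarith [hcon n hn], Finset.sum_nonneg fun t _ => hΛ t n⟩)
  linarith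

/-- `exists_of_sumTilde_pos` in the expanded form produced by `sum_pos_of_bounds`. [folklore] -/
theorem exists_of_pos {τ : Type*} (Nset I : Finset ℕ) (T : Finset τ) (Λsq : τ → ℕ → ℝ)
    (θ' : ℕ → ℝ) (L3N : ℝ) (hΛ : ∀ t n, 0 ≤ Λsq t n)
    (hpos : 0 < ∑ t ∈ T,
      (∑ h₀ ∈ I, ∑ n ∈ Nset, Λsq t n * θ' (n + h₀) - L3N * ∑ n ∈ Nset, Λsq t n)) :
    ∃ n ∈ Nset, L3N < ∑ h₀ ∈ I, θ' (n + h₀) := by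
  rw [← sumTilde_eq] at hpos
  exact exists_of_sumTilde_pos Nset I T Λsq θ' L3N hΛ hpos

/-! ### GPY §3 for Theorem 2: the two main terms, the parameters, the numerics -/

/-- `C(2ℓ+2, ℓ+1) (ℓ+1)² = C(2ℓ, ℓ) (2ℓ+2)(2ℓ+1)` (twice `(n+1) C(n, k) = C(n+1, k+1) (k+1)` and the
symmetry `C(2ℓ+1, ℓ+1) = C(2ℓ+1, ℓ)`). [folklore] -/
theorem choose_succ_half_identity (ℓ : ℕ) :
    (ℓ + ℓ + 2).choose (ℓ + 1) * ((ℓ + 1) * (ℓ + 1)) =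
      (ℓ + ℓ).choose ℓ * ((2 * ℓ + 2) * (2 * ℓ + 1)) := by
  have ha := Nat.add_one_mul_choose_eq (2 * ℓ + 1) ℓ
  have hb := Nat.add_one_mul_choose_eq (2 * ℓ) ℓ
  have hc := Nat.choose_symm_half ℓ
  have e1 : ℓ + ℓ + 2 = 2 * ℓ + 1 + 1 := by ring
  have e2 : ℓ + ℓ = 2 * ℓ := by ring
  rw [e1, e2]
  calc (2 * ℓ + 1 + 1).choose (ℓ + 1) * ((ℓ + 1) * (ℓ + 1))
      = ((2 * ℓ + 1 + 1) * (2 * ℓ + 1).choose ℓ) * (ℓ + 1) := by rw [ha]; ring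
    _ = (2 * ℓ + 1 + 1) * ((2 * ℓ + 1).choose (ℓ + 1) * (ℓ + 1)) := by rw [← hc]; ring
    _ = (2 * ℓ + 1 + 1) * ((2 * ℓ + 1) * (2 * ℓ).choose ℓ) := by rw [← hb]
    _ = (2 * ℓ).choose ℓ * ((2 * ℓ + 2) * (2 * ℓ + 1)) := by ring

/-- The ratio of the main terms of (3.2) and (3.1) (GPY (3.3): the factor
`(2k/(k+2ℓ+1)) ((2ℓ+1)/(ℓ+1)) log R` arises as `k` times this ratio):
`C(2ℓ+2, ℓ+1) (log R)^{e+1}/(e+1)! · (ℓ+1)(e+1) = C(2ℓ, ℓ) (log R)^e/e! · 2(2ℓ+1) · log R`.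
[cite: GoldstonPintzYildirim2009, Section 3 eq. 3.3] -/
theorem mainTerm_succ_mul (ℓ e : ℕ) (R : ℝ) :
    mainTerm (ℓ + ℓ + 2) (ℓ + 1) (e + 1) R * (((ℓ : ℝ) + 1) * ((e : ℝ) + 1)) =
      mainTerm (ℓ + ℓ) ℓ e R * (2 * (2 * (ℓ : ℝ) + 1)) * Real.log R := by
  unfold mainTerm
  have hid : ((ℓ + ℓ + 2).choose (ℓ + 1) : ℝ) * ((ℓ + 1) * (ℓ + 1)) =
      ((ℓ + ℓ).choose ℓ : ℝ) * ((2 * ℓ + 2) * (2 * ℓ + 1)) := by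
    exact_mod_cast choose_succ_half_identity ℓ
  have hfact : ((e + 1).factorial : ℝ) = ((e : ℝ) + 1) * (e.factorial : ℝ) := by
    rw [Nat.factorial_succ]; push_cast; ring
  have hf0 : (e.factorial : ℝ) ≠ 0 := by positivity
  have hl0 : (ℓ : ℝ) + 1 ≠ 0 := by positivity
  have he0 : (e : ℝ) + 1 ≠ 0 := by positivity
  have hid' : ((ℓ + ℓ + 2).choose (ℓ + 1) : ℝ) * ((ℓ : ℝ) + 1) =
      ((ℓ + ℓ).choose ℓ : ℝ) * (2 * (2 * (ℓ : ℝ) + 1)) := by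
    have h' : ((ℓ + ℓ + 2).choose (ℓ + 1) : ℝ) * ((ℓ : ℝ) + 1) * ((ℓ : ℝ) + 1) =
        ((ℓ + ℓ).choose ℓ : ℝ) * (2 * (2 * (ℓ : ℝ) + 1)) * ((ℓ : ℝ) + 1) := by
      linear_combination hid
    exact mul_right_cancel₀ hl0 h'
  rw [hfact, pow_succ]
  field_simp
  linear_combination (Real.log R ^ e * Real.log R) * hid'

/-- The choice of `k` and `ℓ` (GPY (3.9)–(3.10): "letting `ℓ = [√k/2]` and taking `k` sufficiently
large", so that `A = (2k/(k+2ℓ+1)) ((2ℓ+1)/(ℓ+1)) = 4 − O(1/√k)`), made explicit: `ℓ = ⌈16/η⌉`,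
`k = 2(ℓ+1)(2ℓ+1)` give `A ≥ 4 − η/4`, stated denominator-free.
[cite: GoldstonPintzYildirim2009, Section 3 eq. 3.10] -/
theorem exists_params {η : ℝ} (hη : 0 < η) (hη1 : η ≤ 1) :
    ∃ k ℓ : ℕ, 1 ≤ ℓ ∧ ℓ ≤ k ∧
      (4 - η / 4) * (((ℓ : ℝ) + 1) * ((k : ℝ) + 2 * ℓ + 1)) ≤ 2 * (k : ℝ) * (2 * ℓ + 1) := by
  set ℓ := ⌈16 / η⌉₊ with hℓ
  refine ⟨2 * (ℓ + 1) * (2 * ℓ + 1), ℓ, ?_, ?_, ?_⟩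
  · have h16 : (16 : ℝ) ≤ 16 / η := by
      rw [le_div_iff₀ hη]; nlinarith
    have : (1 : ℝ) ≤ ⌈16 / η⌉₊ := le_trans (by linarith) (Nat.le_ceil _)
    exact_mod_cast this
  · nlinarith
  · have hceil : 16 / η ≤ (ℓ : ℝ) := Nat.le_ceil _
    have hηℓ : 16 ≤ η * ℓ := by
      have := mul_le_mul_of_nonneg_left hceil hη.le
      rwa [mul_div_cancel₀ _ hη.ne'] at this
    have hl0 : (0 : ℝ) ≤ ℓ := Nat.cast_nonneg _
    push_cast
    nlinarith [mul_nonneg (mul_nonneg hl0 hl0) hη.le, mul_nonneg hl0 hη.le,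
      mul_nonneg (mul_nonneg (mul_nonneg hl0 hl0) hl0) hη.le]

/-- The numerical heart of (3.9)–(3.10) with `r = 1`, `ϑ = 1/2`: with `A ≥ 4 − η/4`,
`log R = (1/4 − η/64) log N`, `δ = η/64`, `h ≥ (η/2) log N − 1` and `log N ≥ 20/η`, the bracket
`A log R (1 − 4δ) + h (1 − 4δ) − (log 3 + log N)(1 + 4δ)` of (3.8) is positive
(it is `≥ (7η/32) log N − 3 − η/16`). [cite: GoldstonPintzYildirim2009, Section 3 eq. 3.9] -/
theorem numeric_ineq {η L A hr : ℝ} (hη : 0 < η) (hη1 : η ≤ 1) (hA : 4 - η / 4 ≤ A)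
    (hL : 20 / η ≤ L) (hhr : η / 2 * L - 1 ≤ hr) :
    0 < A * ((1 / 4 - η / 64) * L) * (1 - 4 * (η / 64)) + hr * (1 - 4 * (η / 64)) -
      (Real.log 3 + L) * (1 + 4 * (η / 64)) := by
  have hL0 : 0 < L := lt_of_lt_of_le (by positivity) hL
  have hηL : 20 ≤ η * L := by
    have := mul_le_mul_of_nonneg_left hL hη.le
    rwa [mul_div_cancel₀ _ hη.ne'] at this
  have hlog3 : Real.log 3 ≤ 2 := by
    have := Real.log_le_sub_one_of_pos (by norm_num : (0 : ℝ) < 3); linarith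
  have hd : 0 ≤ 1 - 4 * (η / 64) := by linarith
  have hρL : 0 ≤ (1 / 4 - η / 64) * L := by
    apply mul_nonneg <;> linarith
  have h1 : (4 - η / 4) * ((1 / 4 - η / 64) * L) * (1 - 4 * (η / 64)) ≤
      A * ((1 / 4 - η / 64) * L) * (1 - 4 * (η / 64)) := by
    apply mul_le_mul_of_nonneg_right _ hd
    exact mul_le_mul_of_nonneg_right hA hρL
  have h2 : (1 - 3 * η / 16) ≤ (4 - η / 4) * (1 / 4 - η / 64) * (1 - 4 * (η / 64)) := by
    nlinarith [sq_nonneg η, mul_pos hη hη]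
  have h2' : (1 - 3 * η / 16) * L ≤ (4 - η / 4) * (1 / 4 - η / 64) * (1 - 4 * (η / 64)) * L :=
    mul_le_mul_of_nonneg_right h2 hL0.le
  have h3 : (η / 2 * L - 1) * (1 - 4 * (η / 64)) ≤ hr * (1 - 4 * (η / 64)) :=
    mul_le_mul_of_nonneg_right hhr hd
  have h4 : (Real.log 3 + L) * (1 + 4 * (η / 64)) ≤ (2 + L) * (1 + 4 * (η / 64)) := by
    apply mul_le_mul_of_nonneg_right _ (by positivity); linarith
  nlinarith [mul_pos hη hL0, hηL]

/-! ### GPY §3 for Theorem 2: elementary asymptotics used to meet the side conditions -/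

/-- `(log x)^c ≤ x^a` eventually, for `a > 0` (Mathlib's `isLittleO_log_rpow_rpow_atTop`).
[folklore] -/
theorem eventually_log_rpow_le_rpow {a : ℝ} (ha : 0 < a) (c : ℝ) :
    ∀ᶠ x : ℝ in atTop, Real.log x ^ c ≤ x ^ a := by
  have h := (isLittleO_log_rpow_rpow_atTop c ha).bound (one_pos)
  filter_upwards [h, eventually_ge_atTop (0 : ℝ)] with x hx hx0
  rw [one_mul, Real.norm_eq_abs, Real.norm_eq_abs, abs_of_nonneg (Real.rpow_nonneg hx0 a)] at hx
  exact le_trans (le_abs_self _) hx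

/-- `(log x)^n ≤ x^a` eventually, for `a > 0` and a natural exponent `n`. [folklore] -/
theorem eventually_log_pow_le_rpow {a : ℝ} (ha : 0 < a) (n : ℕ) :
    ∀ᶠ x : ℝ in atTop, Real.log x ^ n ≤ x ^ a := by
  filter_upwards [eventually_log_rpow_le_rpow ha n] with x hx
  rwa [Real.rpow_natCast] at hx

/-- `x^ρ ≤ 1 · x^σ / P` when `0 < P ≤ x^{σ − ρ}`: the shape of the range conditions
`R ≤ A N^{1/2}/(log N)^{4M}`, `R ≤ A N^{1/4}/(log N)^B` for `R = N^ρ`. [folklore] -/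
theorem rpow_le_one_mul_div {x ρ σ P : ℝ} (hx : 0 < x) (hP : 0 < P) (hPle : P ≤ x ^ (σ - ρ)) :
    x ^ ρ ≤ 1 * x ^ σ / P := by
  rw [one_mul, le_div_iff₀ hP]
  calc x ^ ρ * P ≤ x ^ ρ * x ^ (σ - ρ) := mul_le_mul_of_nonneg_left hPle (Real.rpow_nonneg hx.le ρ)
    _ = x ^ σ := by rw [← Real.rpow_add hx]; ring_nf

/-- Upper window bound: two applications (at `2N` and at `N`) of an asymptotic
`|S(N') − m s N'| ≤ δ m N'` give `S(2N) − S(N) ≤ m N (s + 3δ)`. [folklore] -/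
theorem window_le {S₁ S₂ m s N δ : ℝ}
    (h2 : |S₂ - m * s * (2 * N)| ≤ δ * (m * (2 * N))) (h1 : |S₁ - m * s * N| ≤ δ * (m * N)) :
    S₂ - S₁ ≤ m * N * (s + 3 * δ) := by
  obtain ⟨h2l, h2u⟩ := abs_le.1 h2
  obtain ⟨h1l, h1u⟩ := abs_le.1 h1
  nlinarith

/-- Lower window bound: `m N (s − 3δ) ≤ S(2N) − S(N)` from the same two applications. [folklore] -/
theorem le_window {S₁ S₂ m s N δ : ℝ}
    (h2 : |S₂ - m * s * (2 * N)| ≤ δ * (m * (2 * N))) (h1 : |S₁ - m * s * N| ≤ δ * (m * N)) :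
    m * N * (s - 3 * δ) ≤ S₂ - S₁ := by
  obtain ⟨h2l, h2u⟩ := abs_le.1 h2
  obtain ⟨h1l, h1u⟩ := abs_le.1 h1
  nlinarith

/-- `∑_{N < n ≤ 2N} f = ∑_{1 ≤ n ≤ 2N} f − ∑_{1 ≤ n ≤ N} f`. [folklore] -/
theorem sum_Ioc_eq_sub (f : ℕ → ℝ) (N : ℕ) :
    ∑ n ∈ Ioc N (2 * N), f n = ∑ n ∈ Icc 1 (2 * N), f n - ∑ n ∈ Icc 1 N, f n := by
  have h := Finset.sum_Ioc_consecutive f (Nat.zero_le N) (by omega : N ≤ 2 * N)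
  have e1 : Icc 1 (2 * N) = Ioc 0 (2 * N) := Finset.Icc_add_one_left_eq_Ioc 0 (2 * N)
  have e2 : Icc 1 N = Ioc 0 N := Finset.Icc_add_one_left_eq_Ioc 0 N
  rw [e1, e2, ← h]
  ring

/-- From `∑(h)/h^k → 1` (the shape of Gallagher's theorem): eventually `|∑(h) − h^k| ≤ δ h^k`.
[folklore] -/
theorem eventually_abs_sub_le_of_tendsto {f : ℕ → ℝ} {k : ℕ}
    (hf : Tendsto (fun h : ℕ => f h / (h : ℝ) ^ k) atTop (𝓝 1)) {δ : ℝ} (hδ : 0 < δ) :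
    ∀ᶠ h : ℕ in atTop, |f h - (h : ℝ) ^ k| ≤ δ * (h : ℝ) ^ k := by
  have h1 := (Metric.tendsto_atTop.1 hf) δ hδ
  obtain ⟨N, hN⟩ := h1
  filter_upwards [eventually_ge_atTop N, eventually_ge_atTop 1] with h hh hh1
  have hk : (0 : ℝ) < (h : ℝ) ^ k := by positivity
  have := hN h hh
  rw [Real.dist_eq] at this
  have e : f h - (h : ℝ) ^ k = (f h / (h : ℝ) ^ k - 1) * (h : ℝ) ^ k := by
    field_simp
  rw [e, abs_mul, abs_of_pos hk]
  exact mul_le_mul_of_nonneg_right this.le hk.le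

/-! ### GPY §3 for Theorem 2: the assembly -/

/-- **GPY §3, (3.5)–(3.10) with `r = 1`, `ϑ = 1/2`.** Assume Propositions 1, 2 and Gallagher's
theorem. For every `0 < η ≤ 1` and all sufficiently large `N` there are `n ∈ (N, 2N]` and
`1 ≤ a < b ≤ h = ⌊(η/2) log N⌋` with `n + a` and `n + b` prime. Proof as printed (p. 8): with
`R = N^{1/4 − η/64}`, `k, ℓ` from `exists_params`, `δ = η/64`, the sum `S̃` of (3.5) over
`N < n ≤ 2N` is expanded tuple by tuple (`sumTilde_eq`); Proposition 1 (at `2N` and `N`,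
`H₁ = H₂ = H_k`, `ℓ₁ = ℓ₂ = ℓ`) bounds `∑ Λ_R(n; H_k, ℓ)²` above, Proposition 2 (cases
`h₀ ∈ H₁ ∩ H₂` and `h₀ ∉ H`) bounds `∑ Λ_R(n; H_k, ℓ)² θ(n + h₀)` below ((3.1), (3.2), (3.6)),
Gallagher's theorem at `k` and, through `sum_distinctTuples_succ`, at `k + 1` evaluates the sums of
singular series ((3.7)), and `sum_pos_of_bounds` with `numeric_ineq` gives `S̃ > 0` ((3.8)–(3.10));
then `exists_of_pos` and `exists_two_primes_of_lt_sum_theta` produce the window. The side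
conditions (`R, N ≥ R₀`; `R ≤ N'^{1/2}/(log N')^{4M}` and `R ≤ N'^{1/4}/(log N')^{B}` at
`N' = N, 2N`; `h ≤ R`; `h` beyond the Gallagher thresholds; `log N ≥ 20/η`) hold eventually by
`eventually_log_pow_le_rpow` / `eventually_log_rpow_le_rpow` and `h → ∞`.
[cite: GoldstonPintzYildirim2009, Section 3 eq. 3.5 to 3.10] -/
theorem eventually_window_two_primes (h₁ : proposition1) (h₂ : proposition2)
    (hG : gallagher_sum_singularSeries) {η : ℝ} (hη : 0 < η) (hη1 : η ≤ 1) :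
    ∀ᶠ N : ℕ in atTop, ∃ n a b : ℕ, N < n ∧ n ≤ 2 * N ∧ 1 ≤ a ∧ a < b ∧
      b ≤ ⌊η / 2 * Real.log N⌋₊ ∧ (n + a).Prime ∧ (n + b).Prime := by
  classical
  -- parameters `k, ℓ, A`
  obtain ⟨k, ℓ, hℓ1, hℓk, hAkl⟩ := exists_params hη hη1
  have hk1 : 1 ≤ k := le_trans hℓ1 hℓk
  have hden : (0 : ℝ) < ((ℓ : ℝ) + 1) * ((k : ℝ) + 2 * ℓ + 1) := by positivity
  obtain ⟨A, hAdef⟩ : ∃ A : ℝ,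
      A = 2 * (k : ℝ) * (2 * ℓ + 1) / (((ℓ : ℝ) + 1) * ((k : ℝ) + 2 * ℓ + 1)) := ⟨_, rfl⟩
  have hA : 4 - η / 4 ≤ A := by rw [hAdef, le_div_iff₀ hden]; exact hAkl
  have hA0 : 0 ≤ A := le_trans (by linarith) hA
  have hAden : A * (((ℓ : ℝ) + 1) * ((k : ℝ) + 2 * ℓ + 1)) = 2 * (k : ℝ) * (2 * ℓ + 1) := by
    rw [hAdef, div_mul_cancel₀ _ hden.ne']
  -- `δ`, `ρ`, `M`
  obtain ⟨δ, hδdef⟩ : ∃ δ : ℝ, δ = η / 64 := ⟨_, rfl⟩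
  have hδ : 0 < δ := by rw [hδdef]; positivity
  obtain ⟨ρ, hρdef⟩ : ∃ ρ : ℝ, ρ = 1 / 4 - η / 64 := ⟨_, rfl⟩
  have hρ : 0 < ρ := by rw [hρdef]; linarith
  have hσ1 : 0 < 1 / 2 - ρ := by rw [hρdef]; linarith
  have hσ2 : 0 < 1 / 4 - ρ := by rw [hρdef]; linarith
  obtain ⟨M, hMdef⟩ : ∃ M : ℕ, M = k + k + ℓ + ℓ := ⟨_, rfl⟩
  -- the named facts
  have h₁' := h₁
  have h₂' := h₂
  have hG' := hG
  dsimp only [proposition1] at h₁'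
  dsimp only [proposition2] at h₂'
  dsimp only [gallagher_sum_singularSeries] at hG'
  obtain ⟨R₁, hR₁⟩ := h₁' M 1 1 δ one_pos one_pos hδ
  obtain ⟨B, -, hB'⟩ := h₂' M
  obtain ⟨R₂, hR₂⟩ := hB' 1 δ one_pos hδ
  have hGk := eventually_abs_sub_le_of_tendsto (hG' k hk1) hδ
  have hGk1 := eventually_abs_sub_le_of_tendsto (hG' (k + 1) (by omega)) hδ
  -- limits
  have hNR : Tendsto (fun N : ℕ => (N : ℝ)) atTop atTop := tendsto_natCast_atTop_atTop
  have h2N : Tendsto (fun N : ℕ => 2 * N) atTop atTop :=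
    Filter.tendsto_atTop_mono (fun N => show N ≤ 2 * N by omega) tendsto_id
  have h2NR : Tendsto (fun N : ℕ => ((2 * N : ℕ) : ℝ)) atTop atTop := hNR.comp h2N
  have hlogN : Tendsto (fun N : ℕ => Real.log N) atTop atTop := Real.tendsto_log_atTop.comp hNR
  have hhN : Tendsto (fun N : ℕ => ⌊η / 2 * Real.log N⌋₊) atTop atTop :=
    tendsto_nat_floor_atTop.comp (hlogN.const_mul_atTop (by positivity))
  have hRN : Tendsto (fun N : ℕ => (N : ℝ) ^ ρ) atTop atTop := (tendsto_rpow_atTop hρ).comp hNR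
  -- eventual conditions in a real variable
  have hx1 : ∀ᶠ x : ℝ in atTop, Real.log x ^ (4 * M) ≤ x ^ (1 / 2 - ρ) :=
    eventually_log_pow_le_rpow hσ1 (4 * M)
  have hx2 : ∀ᶠ x : ℝ in atTop, Real.log x ^ B ≤ x ^ (1 / 4 - ρ) :=
    eventually_log_rpow_le_rpow hσ2 B
  have hx3 : ∀ᶠ x : ℝ in atTop, Real.log x ^ (1 : ℝ) ≤ x ^ ρ := eventually_log_rpow_le_rpow hρ 1
  -- collect everything along `N`
  filter_upwards [hNR.eventually hx1, h2NR.eventually hx1, hNR.eventually hx2, h2NR.eventually hx2,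
    hNR.eventually hx3, hRN.eventually (eventually_ge_atTop R₁),
    hRN.eventually (eventually_ge_atTop R₂), hNR.eventually (eventually_ge_atTop R₁),
    hNR.eventually (eventually_ge_atTop R₂), hRN.eventually (eventually_gt_atTop 1),
    hhN.eventually hGk, hhN.eventually hGk1, hhN.eventually (eventually_ge_atTop 1),
    hlogN.eventually (eventually_ge_atTop (20 / η)), eventually_ge_atTop 2]
    with N hN1 h2N1 hN2 h2N2 hN3 hNR₁ hNR₂ hNR₁' hNR₂' hR1 hGN hGN1 hh1 hlog20 hN2le
  -- names: `h` = window length, `R = N^ρ`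
  obtain ⟨h, hhdef⟩ : ∃ h : ℕ, h = ⌊η / 2 * Real.log N⌋₊ := ⟨_, rfl⟩
  obtain ⟨R, hRdef⟩ : ∃ R : ℝ, R = (N : ℝ) ^ ρ := ⟨_, rfl⟩
  rw [← hhdef] at hGN hGN1 hh1 ⊢
  rw [← hRdef] at hNR₁ hNR₂ hR1
  have hNpos : (0 : ℝ) < N := by exact_mod_cast (by omega : 0 < N)
  have hN1r : (1 : ℝ) < N := by exact_mod_cast (by omega : 1 < N)
  have hlogNpos : 0 < Real.log N := Real.log_pos hN1r
  have hlogR : Real.log R = ρ * Real.log N := by rw [hRdef, Real.log_rpow hNpos]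
  have hlogRpos : 0 < Real.log R := Real.log_pos hR1
  -- bounds on `h`
  have hhle : (h : ℝ) ≤ η / 2 * Real.log N := by
    rw [hhdef]; exact Nat.floor_le (by positivity)
  have hhge : η / 2 * Real.log N - 1 ≤ h := by
    rw [hhdef]; have := Nat.lt_floor_add_one (η / 2 * Real.log N); linarith
  have hhlog : (h : ℝ) ≤ Real.log N := le_trans hhle (by nlinarith)
  have hN3' : Real.log N ≤ (N : ℝ) ^ ρ := by simpa [Real.rpow_one] using hN3
  have hhR : (h : ℝ) ≤ R := by rw [hRdef]; exact le_trans hhlog hN3'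
  have hhR' : (h : ℝ) ≤ R ^ (1 : ℝ) := by rwa [Real.rpow_one]
  have hhN' : h ≤ N := by
    have : (h : ℝ) ≤ N :=
      le_trans hhlog (by have := Real.log_le_sub_one_of_pos hNpos; linarith)
    exact_mod_cast this
  have hhpos : (0 : ℝ) < h := by exact_mod_cast hh1
  -- the ranges of Propositions 1 and 2 at `N` and `2N`
  have h2Npos : (0 : ℝ) < ((2 * N : ℕ) : ℝ) := by positivity
  have hN2N : (N : ℝ) ≤ ((2 * N : ℕ) : ℝ) := by exact_mod_cast (by omega : N ≤ 2 * N)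
  have hR2N : R ≤ ((2 * N : ℕ) : ℝ) ^ ρ := by
    rw [hRdef]; exact Real.rpow_le_rpow hNpos.le hN2N hρ.le
  have hlog2Npos : 0 < Real.log ((2 * N : ℕ) : ℝ) := Real.log_pos (by linarith)
  have hrange1 : R ≤ 1 * (N : ℝ) ^ (1 / 2 : ℝ) / Real.log N ^ (4 * M) := by
    rw [hRdef]; exact rpow_le_one_mul_div hNpos (pow_pos hlogNpos _) hN1
  have hrange1' :
      R ≤ 1 * ((2 * N : ℕ) : ℝ) ^ (1 / 2 : ℝ) / Real.log ((2 * N : ℕ) : ℝ) ^ (4 * M) :=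
    le_trans hR2N (rpow_le_one_mul_div h2Npos (pow_pos hlog2Npos _) h2N1)
  have hrange2 : R ≤ 1 * (N : ℝ) ^ (1 / 4 : ℝ) / Real.log N ^ B := by
    rw [hRdef]; exact rpow_le_one_mul_div hNpos (Real.rpow_pos_of_pos hlogNpos B) hN2
  have hrange2' : R ≤ 1 * ((2 * N : ℕ) : ℝ) ^ (1 / 4 : ℝ) / Real.log ((2 * N : ℕ) : ℝ) ^ B :=
    le_trans hR2N (rpow_le_one_mul_div h2Npos (Real.rpow_pos_of_pos hlog2Npos B) h2N2)
  have hNR₁2 : R₁ ≤ ((2 * N : ℕ) : ℝ) := le_trans hNR₁' hN2N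
  have hNR₂2 : R₂ ≤ ((2 * N : ℕ) : ℝ) := le_trans hNR₂' hN2N
  -- the two main terms `m = c₀ L₀`, `m' = c₁ L₁` and `k m' = A m log R`
  obtain ⟨m, hmdef⟩ : ∃ m : ℝ, m = mainTerm (ℓ + ℓ) ℓ (k + ℓ + ℓ) R := ⟨_, rfl⟩
  obtain ⟨m', hm'def⟩ : ∃ m' : ℝ, m' = mainTerm (ℓ + ℓ + 2) (ℓ + 1) (k + ℓ + ℓ + 1) R := ⟨_, rfl⟩
  have hm : 0 < m := by rw [hmdef]; exact mainTerm_pos (by omega) hR1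
  have hkY : (k : ℝ) * (m' * N) = m * N * (A * Real.log R) := by
    have e1 := mainTerm_succ_mul ℓ (k + ℓ + ℓ) R
    rw [← hmdef, ← hm'def] at e1
    push_cast at e1
    have e2 : m' * (((ℓ : ℝ) + 1) * ((k : ℝ) + 2 * ℓ + 1)) =
        m * (2 * (2 * (ℓ : ℝ) + 1)) * Real.log R := by linear_combination e1
    have h3 : (k : ℝ) * (m' * N) * (((ℓ : ℝ) + 1) * ((k : ℝ) + 2 * ℓ + 1)) =
        m * N * (A * Real.log R) * (((ℓ : ℝ) + 1) * ((k : ℝ) + 2 * ℓ + 1)) := by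
      linear_combination ((k : ℝ) * N) * e2 - (m * N * Real.log R) * hAden
    exact mul_right_cancel₀ hden.ne' h3
  -- per-tuple data
  have hTsub : ∀ t ∈ distinctTuples k h, univ.image t ⊆ Icc 1 h := fun t ht =>
    image_subset_of_mem_distinctTuples ht
  have hTcard : ∀ t ∈ distinctTuples k h, #(univ.image t) = k := fun t ht =>
    card_image_of_mem_distinctTuples ht
  have hTle : ∀ t ∈ distinctTuples k h, ∀ x ∈ univ.image t, x ≤ h := fun t ht x hx =>
    (Finset.mem_Icc.1 (hTsub t ht hx)).2
  have hTne : ∀ t ∈ distinctTuples k h, (univ.image t).Nonempty := by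
    intro t ht; rw [← Finset.card_pos, hTcard t ht]; exact hk1
  have hMeq : ∀ t ∈ distinctTuples k h, #(univ.image t) + #(univ.image t) + ℓ + ℓ = M := by
    intro t ht; rw [hTcard t ht, hMdef]
  have hℓle : ∀ t ∈ distinctTuples k h, ℓ ≤ #(univ.image t) := fun t ht => by
    rw [hTcard t ht]; exact hℓk
  -- Proposition 1 / 2 instantiated at `H₁ = H₂ = H_t`
  have hP1 : ∀ t ∈ distinctTuples k h, ∀ N' : ℕ, R₁ ≤ (N' : ℝ) →
      R ≤ 1 * (N' : ℝ) ^ (1 / 2 : ℝ) / Real.log N' ^ (4 * M) →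
      |∑ n ∈ Icc 1 N', lambdaR R (univ.image t) ℓ n * lambdaR R (univ.image t) ℓ n -
          m * singularSeriesNat (univ.image t) * N'| ≤ δ * (m * N') := by
    intro t ht N' hN' hRN'
    have := hR₁ R N' h (univ.image t) (univ.image t) ℓ ℓ hNR₁ hN' hRN' hhR' (hTle t ht) (hTle t ht)
      (Or.inl (hTne t ht)) (hℓle t ht) (hℓle t ht) (hMeq t ht)
    rwa [Finset.inter_self, Finset.union_self, hTcard t ht, ← hmdef] at this
  have hP2in : ∀ t ∈ distinctTuples k h, ∀ h₀ ∈ univ.image t, ∀ N' : ℕ, R₂ ≤ (N' : ℝ) →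
      R ≤ 1 * (N' : ℝ) ^ (1 / 4 : ℝ) / Real.log N' ^ B →
      |∑ n ∈ Icc 1 N', lambdaR R (univ.image t) ℓ n * lambdaR R (univ.image t) ℓ n *
            theta (n + h₀) - m' * singularSeriesNat (univ.image t) * N'| ≤ δ * (m' * N') := by
    intro t ht h₀ hh₀ N' hN' hRN'
    have hh₀' := Finset.mem_Icc.1 (hTsub t ht hh₀)
    have := (hR₂ R N' h h₀ (univ.image t) (univ.image t) ℓ ℓ hNR₂ hN' hRN' hhR hh₀'.1 hh₀'.2
      (hTle t ht) (hTle t ht) (Or.inl (hTne t ht)) (hℓle t ht) (hℓle t ht) (hMeq t ht)).2.2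
      (Finset.mem_inter.2 ⟨hh₀, hh₀⟩)
    rwa [Finset.inter_self, Finset.union_self, hTcard t ht, ← hm'def] at this
  have hP2out : ∀ t ∈ distinctTuples k h, ∀ h₀ ∈ Icc 1 h \ univ.image t, ∀ N' : ℕ,
      R₂ ≤ (N' : ℝ) → R ≤ 1 * (N' : ℝ) ^ (1 / 4 : ℝ) / Real.log N' ^ B →
      |∑ n ∈ Icc 1 N', lambdaR R (univ.image t) ℓ n * lambdaR R (univ.image t) ℓ n *
            theta (n + h₀) - m * singularSeriesNat (insert h₀ (univ.image t)) * N'| ≤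
        δ * (m * N') := by
    intro t ht h₀ hh₀ N' hN' hRN'
    rw [Finset.mem_sdiff, Finset.mem_Icc] at hh₀
    have := (hR₂ R N' h h₀ (univ.image t) (univ.image t) ℓ ℓ hNR₂ hN' hRN' hhR hh₀.1.1 hh₀.1.2
      (hTle t ht) (hTle t ht) (Or.inl (hTne t ht)) (hℓle t ht) (hℓle t ht) (hMeq t ht)).1
      (by rw [Finset.union_self]; exact hh₀.2)
    rwa [Finset.inter_self, Finset.union_self, hTcard t ht, ← hmdef] at this
  -- positivity of `S̃`
  have hpos : 0 < ∑ t ∈ distinctTuples k h,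
      (∑ h₀ ∈ Icc 1 h, ∑ n ∈ Ioc N (2 * N),
          lambdaR R (univ.image t) ℓ n * lambdaR R (univ.image t) ℓ n * theta (n + h₀) -
        Real.log (3 * N) * ∑ n ∈ Ioc N (2 * N),
          lambdaR R (univ.image t) ℓ n * lambdaR R (univ.image t) ℓ n) := by
    refine sum_pos_of_bounds (distinctTuples k h) (fun t => univ.image t) (Icc 1 h)
      (fun t => ∑ n ∈ Ioc N (2 * N), lambdaR R (univ.image t) ℓ n * lambdaR R (univ.image t) ℓ n)
      (fun t h₀ => ∑ n ∈ Ioc N (2 * N),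
        lambdaR R (univ.image t) ℓ n * lambdaR R (univ.image t) ℓ n * theta (n + h₀))
      singularSeriesNat (X := m * N) (Y := m' * N) (ALR := A * Real.log R)
      (L3N := Real.log (3 * N)) (δ := δ) (hr := h) (k := k) (mul_pos hm hNpos) hhpos
      (mul_nonneg hA0 hlogRpos.le) (Real.log_nonneg (by linarith)) hδ.le hkY
      (by exact_mod_cast card_distinctTuples_le k h)
      (by rw [Nat.card_Icc, Nat.add_sub_cancel]) hTsub hTcard ?_ ?_ ?_ ?_ ?_ ?_
    · -- `ha` from Proposition 1 at `2N` and `N`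
      intro t ht
      rw [sum_Ioc_eq_sub]
      have e2 := hP1 t ht (2 * N) hNR₁2 hrange1'
      have e1 := hP1 t ht N hNR₁' hrange1
      push_cast at e1 e2
      exact window_le e2 e1
    · -- `hb_in` from Proposition 2, case `h₀ ∈ H₁ ∩ H₂`
      intro t ht h₀ hh₀
      rw [sum_Ioc_eq_sub]
      have e2 := hP2in t ht h₀ hh₀ (2 * N) hNR₂2 hrange2'
      have e1 := hP2in t ht h₀ hh₀ N hNR₂' hrange2
      push_cast at e1 e2
      exact le_window e2 e1
    · -- `hb_out` from Proposition 2, case `h₀ ∉ H`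
      intro t ht h₀ hh₀
      rw [sum_Ioc_eq_sub]
      have e2 := hP2out t ht h₀ hh₀ (2 * N) hNR₂2 hrange2'
      have e1 := hP2out t ht h₀ hh₀ N hNR₂' hrange2
      push_cast at e1 e2
      exact le_window e2 e1
    · -- Gallagher at `k`
      exact hGN
    · -- Gallagher at `k + 1`, through the cons bijection
      rw [← sum_distinctTuples_succ k h singularSeriesNat]
      have := (abs_le.1 hGN1).1
      linarith
    · -- the numerical inequality (3.9)–(3.10)
      have hnum := numeric_ineq (A := A) (hr := (h : ℝ)) hη hη1 hA hlog20 hhge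
      have hL3N : Real.log (3 * N) = Real.log 3 + Real.log N :=
        Real.log_mul (by norm_num) hNpos.ne'
      rw [hL3N, hlogR, hρdef, hδdef]
      convert hnum using 2
  -- extract the window with two primes
  obtain ⟨n, hn, hsum⟩ := exists_of_pos (Ioc N (2 * N)) (Icc 1 h) (distinctTuples k h)
    (fun t n => lambdaR R (univ.image t) ℓ n * lambdaR R (univ.image t) ℓ n) theta
    (Real.log (3 * N)) (fun t n => mul_self_nonneg _) hpos
  rw [Finset.mem_Ioc] at hn
  obtain ⟨a, b, ha, hab, hb, hpa, hpb⟩ :=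
    exists_two_primes_of_lt_sum_theta (by omega) hn.2 hhN' hsum
  exact ⟨n, a, b, hn.1, hn.2, ha, hab, hb, hpa, hpb⟩

/-- **parity.S30 from GPY Propositions 1–2 and Gallagher's theorem** — the §3 assembly of
Goldston–Pintz–Yıldırım **Theorem 2**, (1.8): `liminf (p_{n+1} − p_n)/log p_n = 0`, i.e. for every
`ε > 0`, `p_{n+1} − p_n < ε log p_n` infinitely often (`Literature.NumberTheory.Sieve.frequently_nth_prime_gap_lt_mul_log`).
Given `ε`, apply `eventually_window_two_primes` with `η = min ε 1` and `frequently_gap_lt_of_windows`.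
The discharge `frequently_nth_prime_gap_lt_mul_log_holds` is this theorem fed with discharges of the
three named facts (Proposition 2 resting on Bombieri–Vinogradov, parity.S27).
[cite: GoldstonPintzYildirim2009, Theorem 2 eq. 1.8 and Section 3] -/
theorem frequently_nth_prime_gap_lt_mul_log_of_propositions (h₁ : proposition1)
    (h₂ : proposition2) (hG : gallagher_sum_singularSeries) :
    Literature.NumberTheory.Sieve.frequently_nth_prime_gap_lt_mul_log := by
  intro ε hε
  have hη : 0 < min ε 1 := lt_min hε one_pos
  refine frequently_gap_lt_of_windows hε (min_le_left ε 1) (fun N => ⌊min ε 1 / 2 * Real.log N⌋₊)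
    ?_ ((eventually_window_two_primes h₁ h₂ hG hη (min_le_right ε 1)).mono
      fun N ⟨n, a, b, hNn, _, hrest⟩ => ⟨n, a, b, hNn, hrest⟩)
  filter_upwards [eventually_ge_atTop 1] with N hN
  exact Nat.floor_le (by
    have : 0 ≤ Real.log N := Real.log_nonneg (by exact_mod_cast hN)
    positivity)

end Literature.NumberTheory.Sieve.GPY
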